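import Summits.BirchSwinnertonDyer.Rank1Residual.GaloisImage.KolyvaginFiniteSingularAssembly
import Summits.BirchSwinnertonDyer.Rank1Residual.GaloisImage.TateModuleEulerFactorOperator
import HarnessLib

/-!
# The operator `Z_φ = q⁻¹ρ(φ)⁻²(a_q ρ(φ) − q − 1)` on `T_p E` as a function of the Frobenius, and
# the representative-independence of the two sides of the finite–singular relation — preliminaries
# of the THEOREM C END over `ℚ` (cell `b2b-bsdres`, team n1011, seat p11 GEN 9, row T-DER)

HONEST FRAMING (cell `b2b-bsdres`, run/shared/lean/b2b/bsd-rank1-residual/, verbatim in every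
file): the goal of the cell is to DELETE the COMBINATION-SHAPED residual classes of the
Birch–Swinnerton-Dyer formula for ALL analytic-rank `≤ 1` elliptic curves over `ℚ` — "full BSD
formula for every rank `≤ 1` curve in class `C`" assembled STRICTLY from published theorems — so
that the rank-`≤ 1` remainder becomes exactly the CONSTRUCTION-SHAPED classes, which are TYPED
(missing-input `Prop`s), NOT attempted. This is not "finishing BSD". Team n1011: research route on
the CONSTRUCTION-SHAPED class X4 / §I N11 (route-1 PORT, (P-DER)); TOOL theorems (no definition,
no named fact, no `sorry`).

## What

* §1 — the three properties of the operator function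
  `Z_ψ := u⁻¹ • (a_q • ρ(ψ⁻¹) − (q + 1) • ρ(ψ⁻¹)²)` (`u = q ∈ ℤ_pˣ`) consumed by
  `Congruence.Rat.cong_noncommProd_deriv_frobenius_pow_bot` (file C0f): `P_q(ψ⁻¹|T*;ψ⁻¹) =
  (q−1)•Z_ψ`
  for every arithmetic Frobenius `ψ` at `q` (n1011-p13 K4
  `Rat.aeval_galoisRepTate_inv_rubinEulerFactor_apply`), `Z_ψ` commutes with `ρ(ψ)` (K4
  `Rat.commute_galoisRepTate_smul_sub_smul_sq`), and conjugation-equivariance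
  `Z_{w⁻¹ψw} = ρ(w)⁻¹ Z_ψ ρ(w)` (pure algebra).
* §2 — **both sides of THEOREM C depend only on the classes**: for a global cocycle `Φ` and `v`,
  `(Φ + ∂v)(σ) = Φ(σ)` when `σ` acts trivially (`apply_eq_apply_of_oneCocycleClass_eq_of_fix`,
  `exists_apply_eq_apply_add`), and
  `Q(F)(ρ(φ)v − v) = 0` when `P(F)`, `P(1)` kill the module and `(X−1)Q = P − P(1)`, `F = ρ(φ⁻¹)`
  (`aeval_apply_sub_eq_zero`, from G2 `apply_aeval_eq_aeval_of_kill`).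
0 defs, 0 facts.

References: B. Perrin-Riou, Ann. Inst. Fourier 48 (1998), §2.2.4 (`Z(λ)`); K. Rubin, *Euler
Systems* (2000), Thm. 4.5.4; K. Rubin, PCMS 18 (2011), Def. 1.9.6 (`Q(x)`).
-/

noncomputable section

open CategoryTheory Function Finset Polynomial Field IsDedekindDomain
open scoped NumberField
open Literature.NumberTheory.GaloisRepresentations Literature.NumberTheory.EllipticCurves
open Summit.BirchSwinnertonDyer.Rank1Residual.GaloisImage.CyclotomicLevel
open Rat.HeightOneSpectrum

universe u v

namespace Summit.BirchSwinnertonDyer.Rank1Residual.GaloisImage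

namespace Derivative

namespace Rat

/-! ### §1 The operator `Z_ψ` on `T_p E` -/

section Z

variable (W : WeierstrassCurve ℚ) [W.IsElliptic] [W.IsGloballyMinimal] (p : ℕ) [Fact p.Prime]

/-- **`P_q(ψ⁻¹ | T_pE*; ψ⁻¹) = (q − 1) • Z_ψ`** on `T_p E` for EVERY arithmetic Frobenius `ψ` at the
good place `v = q ≠ p`, with `Z_ψ = u⁻¹ • (a_q • ρ(ψ⁻¹) − (q + 1) • ρ(ψ⁻¹)²)` and `u` ANY unit of
`ℤ_p` with `↑u = q` (K4 `Rat.aeval_galoisRepTate_inv_rubinEulerFactor_apply`, whose unit is this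
`u` by `Units.ext`).  The `hZf` binder of file C0f. [cite: PerrinRiou1998AIF, §2.2.4] -/
theorem aeval_rubinEulerFactor_apply_eq_nsmul_Z [Module.Free ℤ_[p] (W.tateModule p)]
    [Module.Finite ℤ_[p] (W.tateModule p)] {v : HeightOneSpectrum (𝓞 ℚ)}
    (hne : ((primesEquiv v : Nat.Primes) : ℕ) ≠ p) (hv : W.HasGoodReductionAt v)
    (u : ℤ_[p]ˣ) (hu : (u : ℤ_[p]) = ((primesEquiv v : Nat.Primes) : ℕ))
    {ψ : absoluteGaloisGroup ℚ} (hψ : IsArithFrobAtPlace ℚ v ψ) (t : W.tateModule p) :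
    aeval (W.galoisRepTate p ψ⁻¹)
        (rubinEulerFactor (W.galoisRepTate p) (cyclotomicCharacterToUnits ℚ p ℤ_[p]) ψ) t =
      ((((primesEquiv v : Nat.Primes) : ℕ) - 1 : ℕ) : ℤ_[p]) •
        ((↑u⁻¹ : ℤ_[p]) • ((W.frobeniusTrace (primesEquiv v) : ℤ_[p]) • W.galoisRepTate p ψ⁻¹ -
          ((((primesEquiv v : Nat.Primes) : ℕ) : ℤ_[p]) + 1) • W.galoisRepTate p ψ⁻¹ ^ 2)) t := by
  obtain ⟨u', hu', h⟩ := CyclotomicLevel.Rat.aeval_galoisRepTate_inv_rubinEulerFactor_apply W p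
      hne hv hψ
  have huu : u' = u := Units.ext (by rw [hu', hu])
  rw [← huu]
  exact h t

omit [W.IsElliptic] [W.IsGloballyMinimal] in
/-- `Z_ψ` commutes with `ρ(ψ)` (K4 `Rat.commute_galoisRepTate_smul_sub_smul_sq`); the `hZfc` binder
of file C0f. [folklore] -/
theorem commute_galoisRepTate_Z (c a' b : ℤ_[p]) (ψ : absoluteGaloisGroup ℚ) :
    Commute (W.galoisRepTate p ψ)
      (c • (a' • W.galoisRepTate p ψ⁻¹ - b • W.galoisRepTate p ψ⁻¹ ^ 2)) :=
  CyclotomicLevel.Rat.commute_galoisRepTate_smul_sub_smul_sq W p ψ c a' b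

omit [W.IsElliptic] [W.IsGloballyMinimal] in
/-- **Conjugation-equivariance `Z_{w⁻¹ψw} = ρ(w)⁻¹ Z_ψ ρ(w)`** (pointwise): the `hZfconj` binder of
file C0f. [folklore] -/
theorem Z_conj_apply (c a' b : ℤ_[p]) (ψ w : absoluteGaloisGroup ℚ) (t : W.tateModule p) :
    (c • (a' • W.galoisRepTate p (w⁻¹ * ψ * w)⁻¹ - b • W.galoisRepTate p (w⁻¹ * ψ * w)⁻¹ ^ 2)) t =
      W.galoisRepTate p w⁻¹ ((c • (a' • W.galoisRepTate p ψ⁻¹ - b • W.galoisRepTate p ψ⁻¹ ^ 2))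
        (W.galoisRepTate p w t)) := by
  have hinv : (w⁻¹ * ψ * w)⁻¹ = w⁻¹ * ψ⁻¹ * w := by group
  have hsq : (w⁻¹ * ψ⁻¹ * w) ^ 2 = w⁻¹ * ψ⁻¹ ^ 2 * w := by
    have h := conj_pow (a := w⁻¹) (b := ψ⁻¹) (i := 2)
    rwa [inv_inv] at h
  have e1 : W.galoisRepTate p (w⁻¹ * ψ⁻¹ * w) =
      W.galoisRepTate p w⁻¹ * W.galoisRepTate p ψ⁻¹ * W.galoisRepTate p w := by
    rw [map_mul, map_mul]
  have e2 : W.galoisRepTate p (w⁻¹ * ψ⁻¹ * w) ^ 2 =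
      W.galoisRepTate p w⁻¹ * W.galoisRepTate p ψ⁻¹ ^ 2 * W.galoisRepTate p w := by
    rw [← map_pow, hsq, map_mul, map_mul, map_pow]
  rw [hinv, e2, e1]
  simp only [LinearMap.smul_apply, LinearMap.sub_apply, Module.End.mul_apply, map_smul, map_sub]

end Z

/-! ### §2 Both sides of the finite–singular relation depend only on the classes -/

section Classes

variable {R : Type v} [CommRing R] [TopologicalSpace R]
variable {G : Type u} [Group G] [TopologicalSpace G] [IsTopologicalGroup G]
variable (X : TopRep.{u} R G)

/-- Two representatives of the same class agree at every `σ` acting trivially on `X`: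
`[Φ] = [Φ'] ⇒ Φ(σ) = Φ'(σ)` (they differ by `∂v`, and `σv − v = 0`). [folklore] -/
theorem apply_eq_apply_of_oneCocycleClass_eq_of_fix (Φ Φ' : contOneCocycles X)
    (h : oneCocycleClass X Φ = oneCocycleClass X Φ') (σ : G) (hσ : ∀ v : X, X.ρ σ v = v) :
    Φ.1 σ = Φ'.1 σ := by
  rw [← sub_eq_zero, ← oneCocycleClass_sub, oneCocycleClass_eq_zero_iff] at h
  obtain ⟨v, hv⟩ := h
  have hσ' := hv σ
  rw [Submodule.coe_sub, ContinuousMap.sub_apply, hσ, sub_self] at hσ'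
  exact sub_eq_zero.mp hσ'

/-- Two representatives of the same class differ at `g` by `ρ(g)v − v`. [folklore] -/
theorem exists_apply_eq_apply_add (Φ Φ' : contOneCocycles X)
    (h : oneCocycleClass X Φ = oneCocycleClass X Φ') (g : G) :
    ∃ v : X, Φ.1 g = Φ'.1 g + (X.ρ g v - v) := by
  rw [← sub_eq_zero, ← oneCocycleClass_sub, oneCocycleClass_eq_zero_iff] at h
  obtain ⟨v, hv⟩ := h
  refine ⟨v, ?_⟩
  have hg := hv g
  rw [Submodule.coe_sub, ContinuousMap.sub_apply, sub_eq_iff_eq_add'] at hg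
  exact hg

omit [TopologicalSpace R] [TopologicalSpace G] [IsTopologicalGroup G] in
/-- **`Q(F)(ρ(φ)v − v) = 0`** when `F ρ(φ) = 1` on the module, `P(F)` and `P(1)` kill it, and
`(X − 1)Q = P − P(1)`: with `w = ρ(φ)v`, `ρ(φ)v − v = w − Fw` and `Q(F)(w − Fw) = Q(F)w − F Q(F)w =
0`
(G2 `apply_aeval_eq_aeval_of_kill`).  So `Q(Fr⁻¹)·Φ_r(Fr)` depends only on the class of `Φ_r`.
[folklore] -/
theorem aeval_apply_sub_eq_zero {Y₀ : Type*} [AddCommGroup Y₀] [Module R Y₀] (F Fi : Module.End R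
    Y₀)
    (hFi : ∀ v : Y₀, F (Fi v) = v) (P Q : R[X]) (hQ : (Polynomial.X - C 1) * Q = P - C (P.eval 1))
    (hP : ∀ w : Y₀, aeval F P w = 0) (hP1 : ∀ w : Y₀, P.eval 1 • w = 0) (v : Y₀) :
    aeval F Q (Fi v - v) = 0 := by
  set w := Fi v with hw
  have hv : v = F w := (hFi v).symm
  have hcomm : aeval F Q (F w) = F (aeval F Q w) := by
    have h := congrArg (fun T : Module.End R Y₀ => T w)
      (commute_aeval_of_commute (Commute.refl F) Q).eq
    simp only [Module.End.mul_apply] at h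
    exact h.symm
  rw [hv, map_sub, hcomm, apply_aeval_eq_aeval_of_kill F P Q hQ w (hP _) (hP1 _), sub_self]

end Classes

end Rat

end Derivative

end Summit.BirchSwinnertonDyer.Rank1Residual.GaloisImage

end
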